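import Mathlib
import Summits.Schanuel.Schanuel.Statement
import Literature.NumberTheory.Transcendental.RoyCriterion
import Literature.NumberTheory.Transcendental.RoyCriterionProofs
import Summits.Schanuel.Schanuel.Theorems.SoloBlindPadeNormalForm
import HarnessLib

/-!
# Padé-type forms satisfy the hypothesis of Roy's Conjecture 2 at every point of the graph of `exp`

`Summits/Schanuel/Schanuel/Theorems/SoloBlindPadeRoyHypothesis.lean` (soloist
`solo-Schanuel-blind`, session 10; companion of `SoloBlindPadeNormalForm.lean`).

Roy's Conjecture 2 (Acta Arith. 97 (2001)) has the hypothesis `RoyHypothesis y α s₀ s₁ t₀ t₁ u`: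
non-zero `P_N ∈ ℤ[X₀,X₁]` of Roy's profile with `|(D^k P_N)(Σ mⱼyⱼ, Π αⱼ^{mⱼ})| ≤ e^{-N^u}` for
`k ≤ N^{s₀}`, `mⱼ ≤ N^{s₁}`.  `royHypothesis_of_pade`: for admissible parameters and ANY `v > u`,
every sequence of non-zero `P_N` with `deg ≤ (N^{t₀}, N^{t₁})`, `H(P_N) ≤ e^N` and
`taylorInt n P_N = 0` for `n ≤ N^v` — integer Padé-type forms `Σ_b A_b(w) e^{bw} = O(w^{N^v})` —
satisfies `RoyHypothesis y (e^{y}) s₀ s₁ t₀ t₁ u` simultaneously for every `l` and every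
`y ∈ ℂ^l` (`universal_of_pade`, then Cauchy's estimate on the unit circle about `Σ mⱼyⱼ` and
`k! e^{-2N^u} ≤ e^{-N^u}`).  With `exists_padeSequence` this recovers Roy's §5, 2° (the hypothesis
holds at `(y, e^y)`), and exhibits the data of Conjecture 2 as what they are: Hermite's
construction at the identity of `G_a × G_m`, transported to `(Σmⱼyⱼ, e^{Σmⱼyⱼ})` by the group law —
available at every point of the graph and silent about the point.

References: D. Roy, *An arithmetic criterion for the values of the exponential function*, Acta
Arith. 97 (2001) 183–194, Conjecture 2 and §5; C. Hermite, *Sur la fonction exponentielle*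
(1873).
-/

noncomputable section

open Filter Complex MvPolynomial Metric

namespace Summit.Schanuel.Schanuel.Theorems

open Literature.NumberTheory.Transcendental

/-- **Padé forms feed Roy's Conjecture 2 at every point of the graph of `exp`.**  For admissible
`(s₀,s₁,t₀,t₁,u)` and any `v > u`: a sequence of non-zero `P_N ∈ ℤ[X₀,X₁]` with Roy's profile and
`taylorInt n P_N = 0` for `n ≤ N^v` satisfies the hypothesis `RoyHypothesis y (e^y) s₀ s₁ t₀ t₁ u`
for EVERY `y : Fin l → ℂ` and every `l` (by `universal_of_pade` and Cauchy's estimate around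
`Σ mⱼyⱼ`). [this work; cf. Roy 2001, §5, 2°] -/
theorem royHypothesis_of_pade {s₀ s₁ t₀ t₁ u v : ℝ} (hadm : RoyAdmissible s₀ s₁ t₀ t₁ u)
    (huv : u < v) (P : ℕ → MvPolynomial (Fin 2) ℤ)
    (hP : ∀ᶠ N : ℕ in atTop, P N ≠ 0 ∧
      ((P N).degreeOf 0 : ℝ) ≤ (N : ℝ) ^ t₀ ∧ ((P N).degreeOf 1 : ℝ) ≤ (N : ℝ) ^ t₁ ∧
      (mvPolyHeight (P N) : ℝ) ≤ Real.exp N ∧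
      ∀ n : ℕ, (n : ℝ) ≤ (N : ℝ) ^ v → taylorInt n (P N) = 0)
    {l : ℕ} (y : Fin l → ℂ) : RoyHypothesis y (cexp ∘ y) s₀ s₁ t₀ t₁ u := by
  have ⟨hs₀, hs₁, ht₀, ht₁, hu, h1, h2, h3⟩ := hadm
  have hmax := max_lt_iff.1 h1
  have hmax' := max_lt_iff.1 hmax.2
  have h1s₀ : 1 < s₀ := lt_of_lt_of_le hmax.1 (min_le_left _ _)
  have ht₀s₀ : t₀ < s₀ := lt_of_lt_of_le hmax'.1 (min_le_left _ _)
  have hs₀u : s₀ < u := lt_of_le_of_lt (le_max_left _ _) h2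
  have hst : s₁ + t₁ < u := lt_of_le_of_lt (le_max_right _ _) h2
  set c : ℝ := ∑ j, ‖y j‖ with hc_def
  have hc : 0 ≤ c := Finset.sum_nonneg fun j _ => norm_nonneg _
  have hsmall := universal_of_pade hs₁.le ht₀.le ht₁.le ((h1s₀.trans hs₀u).trans huv)
    ((ht₀s₀.trans hs₀u).trans huv) (hst.trans huv) huv hc P (hP.mono fun N h => h.2)
  filter_upwards [hP, hsmall, eventually_roy_params hadm hc] with N hN hval hN'
  obtain ⟨hP0, hd0, hd1, hH, -⟩ := hN
  obtain ⟨-, -, -, hfact⟩ := hN'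
  refine ⟨P N, hP0, hd0, hd1, hH, fun k m hk hm => ?_⟩
  set z₀ : ℂ := ∑ j, (m j : ℂ) * y j with hz₀_def
  have hNs : (0 : ℝ) ≤ (N : ℝ) ^ s₁ := Real.rpow_nonneg (Nat.cast_nonneg N) s₁
  have hz₀ : ‖z₀‖ ≤ c * (N : ℝ) ^ s₁ := by
    calc ‖z₀‖ ≤ ∑ j, ‖(m j : ℂ) * y j‖ := norm_sum_le _ _
      _ ≤ ∑ j, (N : ℝ) ^ s₁ * ‖y j‖ := by
          refine Finset.sum_le_sum fun j _ => ?_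
          rw [norm_mul, Complex.norm_natCast]
          exact mul_le_mul_of_nonneg_right (hm j) (norm_nonneg _)
      _ = (N : ℝ) ^ s₁ * ∑ j, ‖y j‖ := by rw [Finset.mul_sum]
      _ = c * (N : ℝ) ^ s₁ := mul_comm _ _
  have hpt : (![∑ j, (m j : ℂ) * y j, ∏ j, (cexp ∘ y) j ^ m j] : Fin 2 → ℂ) =
      ![z₀, cexp z₀] := by
    have : ∏ j, (cexp ∘ y) j ^ m j = cexp z₀ := by
      rw [hz₀_def, Complex.exp_sum]
      refine Finset.prod_congr rfl fun j _ => ?_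
      rw [Function.comp_apply, ← Complex.exp_nat_mul]
    rw [this]
  have hsphere : ∀ z ∈ sphere z₀ 1, ‖expEval (P N) z‖ ≤ Real.exp (-(2 * (N : ℝ) ^ u)) := by
    intro z hz
    refine hval z ?_
    have hz1 : ‖z - z₀‖ = 1 := by simpa [dist_eq_norm] using hz
    calc ‖z‖ = ‖(z - z₀) + z₀‖ := by ring_nf
      _ ≤ ‖z - z₀‖ + ‖z₀‖ := norm_add_le _ _
      _ ≤ 1 + c * (N : ℝ) ^ s₁ := by rw [hz1]; gcongr
  rw [hpt]
  calc ‖aeval ![z₀, cexp z₀] (royD^[k] (P N))‖ = ‖expEval (royD^[k] (P N)) z₀‖ := rfl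
    _ ≤ k.factorial * Real.exp (-(2 * (N : ℝ) ^ u)) :=
        norm_expEval_iterate_royD_le k (P N) z₀ hsphere
    _ ≤ Real.exp (-(N : ℝ) ^ u) := hfact k hk

/-- Roy 2001, §5, 2° recovered through Padé-type forms: the hypothesis of Conjecture 2 holds at
`(y, e^y)` for every `y` and every admissible parameter set. [this work; the statement is Roy 2001,
§5 (2°), in the tree as `royHypothesis_exp'`, here re-derived from Padé-type forms] -/
theorem royHypothesis_exp_of_pade {s₀ s₁ t₀ t₁ u : ℝ} (hadm : RoyAdmissible s₀ s₁ t₀ t₁ u)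
    {l : ℕ} (y : Fin l → ℂ) : RoyHypothesis y (cexp ∘ y) s₀ s₁ t₀ t₁ u := by
  classical
  have ⟨hs₀, hs₁, ht₀, ht₁, hu, h1, h2, h3⟩ := hadm
  -- an admissible exponent strictly between `u` and `(1 + t₀ + t₁)/2`
  set v : ℝ := royLambda t₀ t₁ u with hv
  have huv : u < v := by rw [hv, royLambda]; linarith
  have hv3 : v < (1 + t₀ + t₁) / 2 := by rw [hv, royLambda]; linarith
  have hadm' : RoyAdmissible s₀ s₁ t₀ t₁ v :=
    ⟨hs₀, hs₁, ht₀, ht₁, hu.trans huv, h1, h2.trans huv, hv3⟩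
  let good : ℕ → MvPolynomial (Fin 2) ℤ → Prop := fun N Q =>
    Q ≠ 0 ∧ (Q.degreeOf 0 : ℝ) ≤ (N : ℝ) ^ t₀ ∧ (Q.degreeOf 1 : ℝ) ≤ (N : ℝ) ^ t₁ ∧
      (mvPolyHeight Q : ℝ) ≤ Real.exp N ∧
      ∀ n : ℕ, (n : ℝ) ≤ (N : ℝ) ^ v → taylorInt n Q = 0
  let P : ℕ → MvPolynomial (Fin 2) ℤ := fun N =>
    if hN : ∃ Q, good N Q then hN.choose else 0
  have hP : ∀ᶠ N : ℕ in atTop, good N (P N) := by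
    filter_upwards [exists_padeSequence hadm'] with N hN
    have hex : ∃ Q, good N Q := hN
    show good N (if hN : ∃ Q, good N Q then hN.choose else 0)
    rw [dif_pos hex]
    exact hex.choose_spec
  exact royHypothesis_of_pade hadm huv P hP y

end Summit.Schanuel.Schanuel.Theorems

end
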